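import Summits.ValiantsHypothesis.ValiantsHypothesis.Theorems.LacunarySymmetroidMatrixDescartesCensusV20Check

/-!
# `MatrixDescartes` census — `V = 20` certificate checker: cover checks WITH AN EXCEPTION LIST (definitions)

HONEST FRAMING.  Object-search cell `pub-symmetroid`; door-A item `DoorA26 = PosRootLawAt 2 6 19`
(stmt-ValiantsHypothesis-19979; OPEN, typed, never asserted).  DEFINITIONS ONLY, extending `…CensusV20Check`: the slice cover
check with an explicit list `exc` of EXCLUDED supports (`V20.coverSlicesX`) and a plan check on a range of top exponents
(`V20.planCoversR`).  Use: a box whose 2-Sidon supports are all certified EXCEPT a listed residue (the engine-3 OPEN cells, ATLAS class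
954+) — `…CensusV20Box26*`.  Soundness: `V20.box_of_planX` (`…CensusV20SoundCoverX`).  Nothing here bears on `V = 19`, on `ζ_sym(2,6)`
over all supports, on `MatrixDescartes` (stmt-ValiantsHypothesis-18050) or on `VP ≠ VNP`.

[folklore] Bookkeeping; elementary.
-/

-- the D-0017 layout repeats a namespace component (single-conjunct summit); the `dupNamespace` linter flags it; name mandated.
set_option linter.dupNamespace false

namespace Summit.ValiantsHypothesis.ValiantsHypothesis.Theorems.LacunarySymmetroidMatrixDescartes.Census.V20

/-- Cover check of one support with an exception list: excluded, or not 2-Sidon, or a key, or the mirror of a key. [folklore] -/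
def coverCellX (exc kd km : List (List ℕ)) (f e : ℕ) (l : List ℕ) : Bool :=
  exc.contains (0 :: (l ++ [e, f])) || coverCell kd km f e l

/-- Cover check (with exceptions) of the supports with `d₄ = e`, `d₅ = f`. [folklore] -/
def coverRowX (exc keys : List (List ℕ)) (f e : ℕ) : Bool :=
  (incLists 3 1 (e - 1)).all
    (coverCellX exc ((keysTop keys f).filter fun k => k.getD 4 0 == e)
      ((keysTop keys f).filter fun k => k.getD 1 0 == f - e) f e)

/-- Cover check (with exceptions) of one slice `(f, elo, ehi)`. [folklore] -/
def coverSliceX (exc keys : List (List ℕ)) (s : ℕ × ℕ × ℕ) : Bool :=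
  (List.range' s.2.1 (s.2.2 + 1 - s.2.1)).all fun e => coverRowX exc keys s.1 e

/-- Cover check (with exceptions) of a list of slices. [folklore] -/
def coverSlicesX (exc keys : List (List ℕ)) (L : List (ℕ × ℕ × ℕ)) : Bool := L.all (coverSliceX exc keys)

/-- A slice plan exhausts the tops `lo ≤ f ≤ N`: every `(f, e)` with `4 ≤ e < f` lies in a slice `(f, elo, ehi)`. [folklore] -/
def planCoversR (lo N : ℕ) (P : List (ℕ × ℕ × ℕ)) : Bool :=
  (List.range' lo (N + 1 - lo)).all fun f => (List.range f).all fun e =>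
    !(Nat.ble 4 e) || P.any fun s => (s.1 == f) && Nat.ble s.2.1 e && Nat.ble e s.2.2

end Summit.ValiantsHypothesis.ValiantsHypothesis.Theorems.LacunarySymmetroidMatrixDescartes.Census.V20
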